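import Mathlib

/-!
# Stub `stub_goodPerm` of crux `ChowBorderDepth3.ChowBorderBound` (stmt-ValiantsHypothesis-5936),
# line `registered`

This file proves the purely combinatorial half of the classical fact that the `n × n` permanent
vanishes on no linear subspace cut out by fewer than `n` linear forms: a *pivot-avoiding
permutation with a compatible column ranking*.

## Statement

A cell of the `n × n` grid is a pair `(row, column) : Fin n × Fin n`; a permutation
`σ : Equiv.Perm (Fin n)` occupies the cells `(σ i, i)` (column `i ↦` row `σ i`).  Let
`P : Finset (Fin n × Fin n)` be a set of fewer than `n` "pivot" cells.  Then there are a
permutation `σ` avoiding `P` and an injective ranking `rk : Fin n → ℕ` of the columns such that for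
every pivot `(r, c) ∈ P` the column `σ.symm r` carrying row `r` is ranked strictly after `c`.

## Proof

Rank the columns by putting the pivot columns first: `rk c = c` if `c` is the column of a pivot
and `rk c = n + c` otherwise.  For a row `r` let `θ r` be the maximum of `c + 1` over the pivots
`(r, c)` of that row (`0` if there is none), and call a column `c` *allowed* for `r` if
`θ r ≤ rk c`; an allowed column outranks every pivot column of its row, in particular it is not a
pivot of that row.  It therefore suffices to find a system of distinct representatives
`f : rows → columns` with `f r` allowed for `r` (then `f` is a bijection of `Fin n` and
`σ := f⁻¹`), and by **Hall's marriage theorem**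
(`Finset.all_card_le_biUnion_card_iff_exists_injective`) it suffices to check Hall's condition.
The allowed sets are upper sets of the ranking, hence nested; for a non-empty set `S` of rows let
`r₀ ∈ S` have the smallest threshold.  If `θ r₀ = 0` every column is allowed for `r₀`.  Otherwise
`θ r₀ = c₀ + 1` for a pivot `(r₀, c₀)`, every row of `S` has a pivot in a column `≥ c₀`
(so `#S ≤ #{p ∈ P | c₀ ≤ p.2}`), while the columns that are *not* allowed for `r₀` are pivot
columns `≤ c₀` (so there are at most `#{p ∈ P | p.2 < c₀} + 1` of them); since `#P + 1 ≤ n`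
the two bounds add up to Hall's inequality `#S ≤ #(allowed r₀)`.

## References

Folklore; Hall's marriage theorem is `Mathlib.Combinatorics.Hall.Basic`.
-/

-- `Summit.ValiantsHypothesis.ValiantsHypothesis.…` is the tree's mandated single-conjunct layout
-- (Sub = Summit), so the duplicated namespace component is intended.
set_option linter.dupNamespace false

namespace Summit.ValiantsHypothesis.ValiantsHypothesis.Theorems.ChowBorderBound.GoodPerm

/-- **Stub `stub_goodPerm`** (registered stub of crux stmt-ValiantsHypothesis-5936, line
`registered`): for fewer than `n` pivot cells `P` of the `n × n` grid there are a permutation `σ`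
occupying no pivot cell and an injective column ranking `rk` such that for every pivot `(r, c) ∈ P`
the column `σ.symm r` carrying row `r` is ranked strictly after `c`. -/
theorem stub_goodPerm :
    ∀ (n : ℕ) (P : Finset (Fin n × Fin n)), P.card < n →
    ∃ (σ : Equiv.Perm (Fin n)) (rk : Fin n → ℕ), Function.Injective rk ∧
      (∀ i : Fin n, (σ i, i) ∉ P) ∧ ∀ p ∈ P, rk p.2 < rk (σ.symm p.1) := by
  intro n P hP
  -- the column ranking: pivot columns first
  obtain ⟨rk, hrk⟩ :
      ∃ rk : Fin n → ℕ, ∀ c, rk c = if c ∈ P.image Prod.snd then (c : ℕ) else n + c :=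
    ⟨_, fun _ => rfl⟩
  -- the threshold of a row: one more than the largest index of a pivot column of the row
  obtain ⟨θ, hθ⟩ :
      ∃ θ : Fin n → ℕ, ∀ r, θ r = (P.filter fun p => p.1 = r).sup fun p => (p.2 : ℕ) + 1 :=
    ⟨_, fun _ => rfl⟩
  -- the allowed columns of a row
  obtain ⟨A, hA⟩ :
      ∃ A : Fin n → Finset (Fin n), ∀ r, A r = Finset.univ.filter fun c => θ r ≤ rk c :=
    ⟨_, fun _ => rfl⟩
  have rk_inj : Function.Injective rk := by
    intro a b h
    have ha := a.isLt
    have hb := b.isLt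
    apply Fin.ext
    rw [hrk a, hrk b] at h
    split_ifs at h <;> omega
  -- a pivot column is ranked strictly below the threshold of its row
  have rk_lt : ∀ {r c : Fin n}, (r, c) ∈ P → rk c < θ r := by
    intro r c h
    rw [hrk c, if_pos (Finset.mem_image.2 ⟨(r, c), h, rfl⟩), hθ r]
    have hmem : (r, c) ∈ P.filter (fun p => p.1 = r) := Finset.mem_filter.2 ⟨h, rfl⟩
    exact Finset.le_sup (f := fun p : Fin n × Fin n => (p.2 : ℕ) + 1) hmem
  -- a positive threshold is attained at a pivot of the row
  have θ_eq : ∀ {r : Fin n}, 0 < θ r → ∃ p ∈ P, p.1 = r ∧ θ r = (p.2 : ℕ) + 1 := by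
    intro r h
    rw [hθ r] at h ⊢
    have hne : (P.filter fun p => p.1 = r).Nonempty := by
      rw [Finset.nonempty_iff_ne_empty]
      intro h'
      simp [h'] at h
    obtain ⟨p, hp, hpeq⟩ :=
      Finset.exists_mem_eq_sup _ hne (fun q : Fin n × Fin n => (q.2 : ℕ) + 1)
    rw [Finset.mem_filter] at hp
    exact ⟨p, hp.1, hp.2, hpeq⟩
  have mem_A : ∀ {r c : Fin n}, c ∈ A r ↔ θ r ≤ rk c := by
    intro r c
    simp [hA r]
  -- **Hall's condition** for the allowed columns
  have hall : ∀ S : Finset (Fin n), S.card ≤ (S.biUnion A).card := by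
    intro S
    rcases S.eq_empty_or_nonempty with rfl | hS
    · simp
    obtain ⟨r₀, hr₀, hmin⟩ := S.exists_min_image θ hS
    refine le_trans ?_ (Finset.card_le_card (Finset.subset_biUnion_of_mem A hr₀))
    rcases Nat.eq_zero_or_pos (θ r₀) with h0 | hpos
    · -- every column is allowed for `r₀`
      have hA₀ : A r₀ = Finset.univ := by
        ext c
        simp [mem_A, h0]
      rw [hA₀, Finset.card_univ, Fintype.card_fin]
      exact (Finset.card_le_univ S).trans_eq (Fintype.card_fin n)
    · -- the threshold of `r₀` is attained at a pivot `p₀ = (r₀, c₀)`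
      obtain ⟨p₀, -, -, h₀⟩ := θ_eq hpos
      -- every row of `S` carries a pivot in a column `≥ c₀`
      have h1 : S.card ≤ (P.filter fun p => p₀.2 ≤ p.2).card := by
        calc S.card ≤ ((P.filter fun p => p₀.2 ≤ p.2).image Prod.fst).card := by
              refine Finset.card_le_card fun r hr => ?_
              obtain ⟨p, hp, hp1, hpeq⟩ := θ_eq (hpos.trans_le (hmin r hr))
              have hle := hmin r hr
              rw [h₀, hpeq] at hle
              exact Finset.mem_image.2
                ⟨p, Finset.mem_filter.2 ⟨hp, Fin.le_def.2 (by omega)⟩, hp1⟩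
          _ ≤ (P.filter fun p => p₀.2 ≤ p.2).card := Finset.card_image_le
      -- the columns not allowed for `r₀` are pivot columns `≤ c₀`
      have h2 : (Finset.univ.filter fun c : Fin n => ¬ (p₀.2 : ℕ) < rk c).card ≤
          (P.filter fun p => ¬ p₀.2 ≤ p.2).card + 1 := by
        calc (Finset.univ.filter fun c : Fin n => ¬ (p₀.2 : ℕ) < rk c).card
            ≤ (insert p₀.2 ((P.filter fun p => ¬ p₀.2 ≤ p.2).image Prod.snd)).card := by
              refine Finset.card_le_card fun c hc => ?_
              rw [Finset.mem_filter, hrk c] at hc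
              rw [Finset.mem_insert, Finset.mem_image]
              by_cases hcP : c ∈ P.image Prod.snd
              · rw [if_pos hcP] at hc
                rcases eq_or_ne c p₀.2 with hc₀ | hc₀
                · exact Or.inl hc₀
                · have hne : (c : ℕ) ≠ p₀.2 := fun h' => hc₀ (Fin.ext h')
                  obtain ⟨p, hp, hpc⟩ := Finset.mem_image.1 hcP
                  refine Or.inr ⟨p, Finset.mem_filter.2 ⟨hp, ?_⟩, hpc⟩
                  rw [hpc, not_le, Fin.lt_def]
                  omega
              · rw [if_neg hcP] at hc
                have := p₀.2.isLt
                omega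
          _ ≤ ((P.filter fun p => ¬ p₀.2 ≤ p.2).image Prod.snd).card + 1 :=
              Finset.card_insert_le _ _
          _ ≤ (P.filter fun p => ¬ p₀.2 ≤ p.2).card + 1 :=
              Nat.add_le_add_right Finset.card_image_le 1
      have h3 : (P.filter fun p => p₀.2 ≤ p.2).card + (P.filter fun p => ¬ p₀.2 ≤ p.2).card =
          P.card :=
        Finset.card_filter_add_card_filter_not _
      have h4 : (Finset.univ.filter fun c : Fin n => (p₀.2 : ℕ) < rk c).card +
          (Finset.univ.filter fun c : Fin n => ¬ (p₀.2 : ℕ) < rk c).card =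
          (Finset.univ : Finset (Fin n)).card :=
        Finset.card_filter_add_card_filter_not _
      rw [Finset.card_univ, Fintype.card_fin] at h4
      have h5 : A r₀ = Finset.univ.filter fun c : Fin n => (p₀.2 : ℕ) < rk c := by
        rw [hA r₀, h₀]
        rfl
      rw [h5]
      omega
  -- a system of distinct allowed representatives, i.e. a bijection `f : rows → columns`
  obtain ⟨f, hf, hfA⟩ := (Finset.all_card_le_biUnion_card_iff_exists_injective A).1 hall
  have hbij : Function.Bijective f := Finite.injective_iff_bijective.1 hf
  have key : ∀ r c : Fin n, (r, c) ∈ P → rk c < rk (f r) := fun r _ h =>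
    (rk_lt h).trans_le (mem_A.1 (hfA r))
  refine ⟨(Equiv.ofBijective f hbij).symm, rk, rk_inj, fun i hi => ?_, fun p hp => ?_⟩
  · have h := key _ _ hi
    rw [Equiv.ofBijective_apply_symm_apply f hbij] at h
    exact lt_irrefl _ h
  · rw [Equiv.symm_symm, Equiv.coe_ofBijective]
    exact key p.1 p.2 hp

end Summit.ValiantsHypothesis.ValiantsHypothesis.Theorems.ChowBorderBound.GoodPerm
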